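import Summits.Parity.GeneralizedHardyLittlewood.Theorems.LeeYangFibresRelativeDimOneMoebiusSplitSingularSeriesAux1
import Literature.NumberTheory.Sieve.LinearEquationsInPrimesSingularSeries
import HarnessLib

/-!
# Crux `RelativeDimOne` (stmt-Parity-14113), line `single-moebius-split`, stub `stub_truncSingularSeries`:
# auxiliary file 2 — Euler-product bounds for the twisted one-variable Goldston–Yıldırım lemma

For a prime twist `w` with `|p w(p) − 1| ≤ K/p` off a finite set `Q` of primes and `|p w(p)| ≤ K` on `Q`, the
local deviations `c_p = 1 − p w(p)` satisfy `|c_p| ≤ K/p` resp. `≤ K + 1`, and the two Euler products that control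
the moments `∑ |F|`, `∑ |F(d)| √d` of `F(d) = ∏_{p∣d} c_p / d` are bounded uniformly in the range of primes:
`∏_p (1 + |c_p|/(p−1)) ≤ e^{2K} (|Q|+1)^{K+1}` and `∏_{p<y} (1 + 4|c_p| p^{-1/2}) ≤ e^{8K} e^{8(K+1)√(|Q|+1)}`
(`tss_euler_bounds`, registered), using the tree's `∏_{p∈Q}(1−1/p)⁻¹ ≤ |Q|+1`, `∑_{p∈Q} p^{-1/2} ≤ 2√(|Q|+1)`,
`∑_p p^{-3/2} ≤ 2`. Also two absorption inequalities (`(Bs²+1)^n e^{−as} ≤ M`, completing the square) used when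
`|Q| ≤ B log u` is fed into the power savings of the twisted lemma (`…SingularSeriesAux3`).

References: D. A. Goldston, C. Y. Yıldırım, Integers 3 (2003) A5 = arXiv:math/0111212, Lemma 2.1 and §3
[GoldstonYildirim2001]; B. Green, T. Tao, Ann. of Math. 171 (2010), App. D [GreenTao2010].
-/

noncomputable section

open Finset Real ArithmeticFunction Filter
open scoped ArithmeticFunction.Moebius Topology

namespace Summit.Parity.GeneralizedHardyLittlewood.Cruxes.RelativeDimOne.SingleMoebiusSplit

namespace TSSGtl

open Literature.NumberTheory.Sieve

/-! ### Euler-product bounds over finite sets of primes -/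

/-- The local deviations: `|1 − p w(p)| ≤ K/p` off `Q` and `≤ K + 1` on `Q`. [folklore] -/
theorem abs_one_sub_le {w : ℕ → ℝ} {Q : Finset ℕ} {K : ℕ}
    (hgen : ∀ p : ℕ, p.Prime → p ∉ Q → |(p : ℝ) * w p - 1| ≤ K / p) (hQ : ∀ p ∈ Q, |(p : ℝ) * w p| ≤ K)
    {p : ℕ} (hp : p.Prime) :
    |1 - (p : ℝ) * w p| ≤ if p ∈ Q then (K : ℝ) + 1 else (K : ℝ) / p := by
  split_ifs with h
  · calc |1 - (p : ℝ) * w p| ≤ |(1 : ℝ)| + |(p : ℝ) * w p| := abs_sub _ _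
      _ ≤ 1 + K := by rw [abs_one]; exact add_le_add le_rfl (hQ p h)
      _ = K + 1 := add_comm _ _
  · rw [abs_sub_comm]; exact hgen p hp h

/-- `∏_{p ∈ P} (1 + |1 − p w(p)|/(p−1)) ≤ e^{2K} (|Q| + 1)^{K+1}` for a finite set of primes `P`
(off `Q`: `∑_p K/(p(p−1)) ≤ 2K ∑ 1/p² ≤ 2K`; on `Q`: `1 + (K+1)/(p−1) ≤ (1 − 1/p)^{−(K+1)}` and
`∏_{p∈Q}(1 − 1/p)⁻¹ ≤ |Q| + 1`). [folklore] -/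
theorem prod_one_add_abs_div_le {w : ℕ → ℝ} {Q : Finset ℕ} {K : ℕ} (hQp : ∀ p ∈ Q, p.Prime)
    (hgen : ∀ p : ℕ, p.Prime → p ∉ Q → |(p : ℝ) * w p - 1| ≤ K / p) (hQ : ∀ p ∈ Q, |(p : ℝ) * w p| ≤ K)
    (P : Finset ℕ) (hP : ∀ p ∈ P, p.Prime) :
    ∏ p ∈ P, (1 + |1 - (p : ℝ) * w p| / ((p : ℝ) - 1)) ≤ Real.exp (2 * K) * ((Q.card : ℝ) + 1) ^ (K + 1) := by
  have hfac0 : ∀ p ∈ P, (0 : ℝ) ≤ |1 - (p : ℝ) * w p| / ((p : ℝ) - 1) := fun p hp => by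
    have : (2 : ℝ) ≤ p := by exact_mod_cast (hP p hp).two_le
    exact div_nonneg (abs_nonneg _) (by linarith)
  rw [← Finset.prod_filter_mul_prod_filter_not P (fun p => p ∉ Q)]
  refine mul_le_mul ?_ ?_ (Finset.prod_nonneg fun p hp => by
    linarith [hfac0 p (Finset.mem_filter.1 hp).1]) (Real.exp_pos _).le
  · -- generic primes
    calc ∏ p ∈ P.filter (fun p => p ∉ Q), (1 + |1 - (p : ℝ) * w p| / ((p : ℝ) - 1))
        ≤ ∏ p ∈ P.filter (fun p => p ∉ Q), (1 + 2 * K * ((p : ℝ) ^ 2)⁻¹) := by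
          refine Finset.prod_le_prod (fun p hp => by linarith [hfac0 p (Finset.mem_filter.1 hp).1])
            fun p hp => ?_
          obtain ⟨hpP, hpQ⟩ := Finset.mem_filter.1 hp
          have hp2 : (2 : ℝ) ≤ p := by exact_mod_cast (hP p hpP).two_le
          have hp0 : (0 : ℝ) < p := by linarith
          have h1 : |1 - (p : ℝ) * w p| ≤ K / p := by
            have := abs_one_sub_le hgen hQ (hP p hpP); rwa [if_neg hpQ] at this
          have h2 : |1 - (p : ℝ) * w p| / ((p : ℝ) - 1) ≤ (K / p) / ((p : ℝ) - 1) :=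
            div_le_div_of_nonneg_right h1 (by linarith)
          have h3 : (K / p) / ((p : ℝ) - 1) ≤ 2 * K * ((p : ℝ) ^ 2)⁻¹ := by
            rw [div_div, div_le_iff₀ (by nlinarith)]
            have hK : (0 : ℝ) ≤ K := Nat.cast_nonneg K
            have : 2 * (K : ℝ) * ((p : ℝ) ^ 2)⁻¹ * (p * (p - 1)) = K * (2 * (p - 1) / p) := by
              field_simp
            rw [this]
            have h4 : (1 : ℝ) ≤ 2 * (p - 1) / p := by rw [le_div_iff₀ hp0]; linarith
            nlinarith
          linarith
      _ ≤ Real.exp (∑ p ∈ P.filter (fun p => p ∉ Q), 2 * K * ((p : ℝ) ^ 2)⁻¹) :=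
          SquarefreeSums.prod_one_add_le_exp_sum fun p _ => by positivity
      _ ≤ Real.exp (2 * K) := by
          refine Real.exp_le_exp.2 ?_
          rw [← Finset.mul_sum]
          have hK : (0 : ℝ) ≤ 2 * K := by positivity
          refine (mul_le_mul_of_nonneg_left ?_ hK).trans (le_of_eq (mul_one _))
          obtain ⟨X, hX⟩ : ∃ X, ∀ p ∈ P.filter (fun p => p ∉ Q), p ≤ X :=
            ⟨P.sup id, fun p hp => Finset.le_sup (f := id) (Finset.mem_filter.1 hp).1⟩
          calc ∑ p ∈ P.filter (fun p => p ∉ Q), ((p : ℝ) ^ 2)⁻¹ ≤ ∑ n ∈ Finset.Ioc 1 X, ((n : ℝ) ^ 2)⁻¹ := by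
                refine Finset.sum_le_sum_of_subset_of_nonneg (fun p hp => ?_) fun _ _ _ => by positivity
                exact Finset.mem_Ioc.2 ⟨(hP p (Finset.mem_filter.1 hp).1).one_lt, hX p hp⟩
            _ ≤ (1 : ℝ)⁻¹ := by exact_mod_cast sum_Ioc_inv_sq_le le_rfl X
            _ = 1 := inv_one
  · -- the primes of `Q`
    have hsub : P.filter (fun p => ¬ p ∉ Q) ⊆ Q := fun p hp => by
      have := (Finset.mem_filter.1 hp).2; push Not at this; exact this
    set P' := P.filter (fun p => ¬ p ∉ Q) with hP'
    have hP'p : ∀ p ∈ P', p.Prime := fun p hp => hQp p (hsub hp)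
    calc ∏ p ∈ P', (1 + |1 - (p : ℝ) * w p| / ((p : ℝ) - 1))
        ≤ ∏ p ∈ P', ((1 - (p : ℝ)⁻¹)⁻¹) ^ (K + 1) := by
          refine Finset.prod_le_prod (fun p hp => by
            linarith [hfac0 p (Finset.mem_filter.1 hp).1]) fun p hp => ?_
          have hpp := hP'p p hp
          have hp2 : (2 : ℝ) ≤ p := by exact_mod_cast hpp.two_le
          have hp0 : (0 : ℝ) < p := by linarith
          have h1 : |1 - (p : ℝ) * w p| ≤ K + 1 := by
            have := abs_one_sub_le hgen hQ hpp; rwa [if_pos (hsub hp)] at this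
          have hp1 : (p : ℝ) - 1 ≠ 0 := by linarith
          have hinv : (1 - (p : ℝ)⁻¹)⁻¹ = 1 + 1 / ((p : ℝ) - 1) := by
            field_simp
            ring
          rw [hinv]
          calc 1 + |1 - (p : ℝ) * w p| / ((p : ℝ) - 1) ≤ 1 + ((K + 1 : ℕ) : ℝ) * (1 / ((p : ℝ) - 1)) := by
                push_cast
                rw [mul_one_div]
                exact add_le_add le_rfl (div_le_div_of_nonneg_right h1 (by linarith))
            _ ≤ (1 + 1 / ((p : ℝ) - 1)) ^ (K + 1) :=
                one_add_mul_le_pow (by have : (0 : ℝ) ≤ 1 / ((p : ℝ) - 1) := div_nonneg zero_le_one (by linarith)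
                                       linarith) _
      _ = (∏ p ∈ P', (1 - (p : ℝ)⁻¹)⁻¹) ^ (K + 1) := Finset.prod_pow _ _ _
      _ ≤ ((P'.card : ℝ) + 1) ^ (K + 1) := by
          refine pow_le_pow_left₀ (Finset.prod_nonneg fun p hp => ?_)
            (GoldstonYildirimLemma21.prod_inv_one_sub_inv_le_card P' hP'p) _
          have hp2 : (2 : ℝ) ≤ p := by exact_mod_cast (hP'p p hp).two_le
          exact inv_nonneg.2 (by rw [sub_nonneg]; exact inv_le_one_of_one_le₀ (by linarith))
      _ ≤ ((Q.card : ℝ) + 1) ^ (K + 1) := by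
          gcongr

/-- `∏_{p ∈ P} (1 + |1 − p w(p)| · 4 p^{-1/2}) ≤ e^{8K} e^{8(K+1)√(|Q|+1)}` for `P ⊆` primes `< y`
(off `Q`: `∑_p p^{-3/2} ≤ 2`; on `Q`: `∑_{p∈Q} p^{-1/2} ≤ 2√(|Q|+1)`). [folklore] -/
theorem prod_one_add_abs_rpow_le {w : ℕ → ℝ} {Q : Finset ℕ} {K : ℕ} (hQp : ∀ p ∈ Q, p.Prime)
    (hgen : ∀ p : ℕ, p.Prime → p ∉ Q → |(p : ℝ) * w p - 1| ≤ K / p) (hQ : ∀ p ∈ Q, |(p : ℝ) * w p| ≤ K)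
    (y : ℕ) :
    ∏ p ∈ Nat.primesBelow y, (1 + |1 - (p : ℝ) * w p| * (4 * (p : ℝ) ^ (-(1 / 2 : ℝ)))) ≤
      Real.exp (8 * K) * Real.exp (8 * (K + 1) * Real.sqrt (Q.card + 1)) := by
  set P := Nat.primesBelow y with hPdef
  have hP : ∀ p ∈ P, p.Prime := fun p hp => (Nat.mem_primesBelow.1 hp).2
  have hfac0 : ∀ p ∈ P, (0 : ℝ) ≤ |1 - (p : ℝ) * w p| * (4 * (p : ℝ) ^ (-(1 / 2 : ℝ))) := fun p _ => by
    positivity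
  rw [← Finset.prod_filter_mul_prod_filter_not P (fun p => p ∉ Q)]
  refine mul_le_mul ?_ ?_ (Finset.prod_nonneg fun p hp => by
    linarith [hfac0 p (Finset.mem_filter.1 hp).1]) (Real.exp_pos _).le
  · calc ∏ p ∈ P.filter (fun p => p ∉ Q), (1 + |1 - (p : ℝ) * w p| * (4 * (p : ℝ) ^ (-(1 / 2 : ℝ))))
        ≤ ∏ p ∈ P.filter (fun p => p ∉ Q), (1 + 4 * K * (p : ℝ) ^ (-(3 : ℝ) / 2)) := by
          refine Finset.prod_le_prod (fun p hp => by linarith [hfac0 p (Finset.mem_filter.1 hp).1])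
            fun p hp => ?_
          obtain ⟨hpP, hpQ⟩ := Finset.mem_filter.1 hp
          have hp0 : (0 : ℝ) < p := by exact_mod_cast (hP p hpP).pos
          have h1 : |1 - (p : ℝ) * w p| ≤ K / p := by
            have := abs_one_sub_le hgen hQ (hP p hpP); rwa [if_neg hpQ] at this
          have h2 : (K : ℝ) / p * (4 * (p : ℝ) ^ (-(1 / 2 : ℝ))) = 4 * K * (p : ℝ) ^ (-(3 : ℝ) / 2) := by
            rw [show (-(3 : ℝ) / 2) = -1 + (-(1 / 2 : ℝ)) by norm_num, Real.rpow_add hp0,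
              Real.rpow_neg_one]
            ring
          have := mul_le_mul_of_nonneg_right h1 (by positivity : (0 : ℝ) ≤ 4 * (p : ℝ) ^ (-(1 / 2 : ℝ)))
          linarith
      _ ≤ Real.exp (∑ p ∈ P.filter (fun p => p ∉ Q), 4 * K * (p : ℝ) ^ (-(3 : ℝ) / 2)) :=
          SquarefreeSums.prod_one_add_le_exp_sum fun p _ => by positivity
      _ ≤ Real.exp (8 * K) := by
          refine Real.exp_le_exp.2 ?_
          rw [← Finset.mul_sum]
          have hK : (0 : ℝ) ≤ 4 * K := by positivity
          calc 4 * (K : ℝ) * ∑ p ∈ P.filter (fun p => p ∉ Q), (p : ℝ) ^ (-(3 : ℝ) / 2)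
              ≤ 4 * K * ∑ p ∈ Nat.primesBelow (y + 1), (p : ℝ) ^ (-(3 : ℝ) / 2) := by
                refine mul_le_mul_of_nonneg_left ?_ hK
                refine Finset.sum_le_sum_of_subset_of_nonneg ?_ fun _ _ _ => by positivity
                intro p hp
                have := Nat.mem_primesBelow.1 (Finset.mem_filter.1 hp).1
                exact Nat.mem_primesBelow.2 ⟨by omega, this.2⟩
            _ ≤ 4 * K * 2 := mul_le_mul_of_nonneg_left (SquarefreeSums.sum_primesBelow_rpow_le y) hK
            _ = 8 * K := by ring
  · have hsub : P.filter (fun p => ¬ p ∉ Q) ⊆ Q := fun p hp => by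
      have := (Finset.mem_filter.1 hp).2; push Not at this; exact this
    set P' := P.filter (fun p => ¬ p ∉ Q) with hP'
    have hP'p : ∀ p ∈ P', p.Prime := fun p hp => hQp p (hsub hp)
    calc ∏ p ∈ P', (1 + |1 - (p : ℝ) * w p| * (4 * (p : ℝ) ^ (-(1 / 2 : ℝ))))
        ≤ ∏ p ∈ P', (1 + 4 * (K + 1) * (p : ℝ) ^ (-(1 / 2 : ℝ))) := by
          refine Finset.prod_le_prod (fun p hp => by linarith [hfac0 p (Finset.mem_filter.1 hp).1])
            fun p hp => ?_
          have h1 : |1 - (p : ℝ) * w p| ≤ K + 1 := by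
            have := abs_one_sub_le hgen hQ (hP'p p hp); rwa [if_pos (hsub hp)] at this
          have := mul_le_mul_of_nonneg_right h1 (by positivity : (0 : ℝ) ≤ 4 * (p : ℝ) ^ (-(1 / 2 : ℝ)))
          linarith
      _ ≤ Real.exp (∑ p ∈ P', 4 * (K + 1) * (p : ℝ) ^ (-(1 / 2 : ℝ))) :=
          SquarefreeSums.prod_one_add_le_exp_sum fun p _ => by positivity
      _ ≤ Real.exp (8 * (K + 1) * Real.sqrt (Q.card + 1)) := by
          refine Real.exp_le_exp.2 ?_
          rw [← Finset.mul_sum]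
          have hK : (0 : ℝ) ≤ 4 * (K + 1) := by positivity
          calc 4 * ((K : ℝ) + 1) * ∑ p ∈ P', (p : ℝ) ^ (-(1 / 2 : ℝ))
              ≤ 4 * (K + 1) * (2 * Real.sqrt (P'.card + 1)) :=
                mul_le_mul_of_nonneg_left (GoldstonYildirimLemma21.sum_rpow_neg_half_le_sqrt_card P' hP'p) hK
            _ ≤ 4 * (K + 1) * (2 * Real.sqrt (Q.card + 1)) := by
                gcongr
            _ = 8 * (K + 1) * Real.sqrt (Q.card + 1) := by ring

/-! ### Absorbing polynomial and `e^{O(√log)}` factors -/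

/-- `(B s² + 1)^n e^{−a s} ≤ M(a, n, B)` for all `s ≥ 0` (`a > 0`). [folklore] -/
theorem exists_pow_mul_exp_neg_le {a : ℝ} (ha : 0 < a) (n : ℕ) {B : ℝ} (hB : 0 ≤ B) :
    ∃ M : ℝ, 0 ≤ M ∧ ∀ s : ℝ, 0 ≤ s → (B * s ^ 2 + 1) ^ n * Real.exp (-(a * s)) ≤ M := by
  refine ⟨(B + 1) ^ n * ((2 * n).factorial / a ^ (2 * n)) * Real.exp a, by positivity, fun s hs => ?_⟩
  have h1 : B * s ^ 2 + 1 ≤ (B + 1) * (s + 1) ^ 2 := by nlinarith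
  have h2 : (B * s ^ 2 + 1) ^ n ≤ (B + 1) ^ n * ((s + 1) ^ 2) ^ n := by
    rw [← mul_pow]; exact pow_le_pow_left₀ (by positivity) h1 n
  -- `(a(s+1))^{2n}/(2n)! ≤ e^{a(s+1)}`
  have h3 := Real.pow_div_factorial_le_exp (a * (s + 1)) (by positivity) (2 * n)
  have h4 : ((s + 1) ^ 2) ^ n * Real.exp (-(a * s)) ≤ (2 * n).factorial / a ^ (2 * n) * Real.exp a := by
    rw [← pow_mul]
    have hfpos : (0 : ℝ) < (2 * n).factorial := by exact_mod_cast Nat.factorial_pos _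
    have hapos : (0 : ℝ) < a ^ (2 * n) := by positivity
    rw [div_le_iff₀ hfpos, mul_pow] at h3
    -- h3 : a^(2n) (s+1)^(2n) ≤ exp(a(s+1)) * (2n)!
    have h5 : (s + 1) ^ (2 * n) ≤ (2 * n).factorial / a ^ (2 * n) * Real.exp (a * (s + 1)) := by
      rw [div_mul_eq_mul_div, le_div_iff₀ hapos]
      nlinarith
    calc (s + 1) ^ (2 * n) * Real.exp (-(a * s))
        ≤ (2 * n).factorial / a ^ (2 * n) * Real.exp (a * (s + 1)) * Real.exp (-(a * s)) :=
          mul_le_mul_of_nonneg_right h5 (Real.exp_pos _).le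
      _ = (2 * n).factorial / a ^ (2 * n) * Real.exp a := by
          rw [mul_assoc, ← Real.exp_add]; ring_nf
  calc (B * s ^ 2 + 1) ^ n * Real.exp (-(a * s)) ≤ (B + 1) ^ n * ((s + 1) ^ 2) ^ n * Real.exp (-(a * s)) :=
        mul_le_mul_of_nonneg_right h2 (Real.exp_pos _).le
    _ = (B + 1) ^ n * (((s + 1) ^ 2) ^ n * Real.exp (-(a * s))) := by ring
    _ ≤ (B + 1) ^ n * ((2 * n).factorial / a ^ (2 * n) * Real.exp a) :=
        mul_le_mul_of_nonneg_left h4 (by positivity)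
    _ = _ := by ring

/-- `e^{−s²/4} e^{b s} ≤ e^{(b+c)²} e^{−c s}` (complete the square). [folklore] -/
theorem exp_neg_sq_mul_exp_le (b c s : ℝ) :
    Real.exp (-(s ^ 2 / 4)) * Real.exp (b * s) ≤ Real.exp ((b + c) ^ 2) * Real.exp (-(c * s)) := by
  rw [← Real.exp_add, ← Real.exp_add]
  exact Real.exp_le_exp.2 (by nlinarith [sq_nonneg (s / 2 - (b + c))])

end TSSGtl

/-! ### The registered sub-goal of this file -/

open TSSGtl in
/-- **Euler-product bounds for the twisted GY lemma** (sub-goal `tss_euler_bounds` of `stub_truncSingularSeries`):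
for a prime twist `w` with `|p w(p) − 1| ≤ K/p` off the finite set of primes `Q` and `|p w(p)| ≤ K` on `Q`, for
every `y`: `∏_{p<y} (1 + |1 − p w(p)|/(p−1)) ≤ e^{2K}(|Q|+1)^{K+1}` and
`∏_{p<y} (1 + 4 |1 − p w(p)| p^{-1/2}) ≤ e^{8K} e^{8(K+1)√(|Q|+1)}`. [folklore] -/
theorem tss_euler_bounds : ∀ (w : ℕ → ℝ) (Q : Finset ℕ) (K : ℕ), (∀ p ∈ Q, p.Prime) →
    (∀ p : ℕ, p.Prime → p ∉ Q → |(p : ℝ) * w p - 1| ≤ K / p) → (∀ p ∈ Q, |(p : ℝ) * w p| ≤ K) →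
    ∀ y : ℕ, (∏ p ∈ Nat.primesBelow y, (1 + |1 - (p : ℝ) * w p| / ((p : ℝ) - 1)) ≤
        Real.exp (2 * K) * ((Q.card : ℝ) + 1) ^ (K + 1)) ∧
      (∏ p ∈ Nat.primesBelow y, (1 + |1 - (p : ℝ) * w p| * (4 * (p : ℝ) ^ (-(1 / 2 : ℝ)))) ≤
        Real.exp (8 * K) * Real.exp (8 * (K + 1) * Real.sqrt (Q.card + 1))) :=
  fun _ _ _ hQp hgen hQ y =>
    ⟨prod_one_add_abs_div_le hQp hgen hQ _ fun _ hp => (Nat.mem_primesBelow.1 hp).2,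
      prod_one_add_abs_rpow_le hQp hgen hQ y⟩

end Summit.Parity.GeneralizedHardyLittlewood.Cruxes.RelativeDimOne.SingleMoebiusSplit

end
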